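import Mathlib.MeasureTheory.Function.L2Space
import Summits.RiemannHypothesis.RiemannHypothesis.Theorems.RuelleBandCofiniteCriticalLineStubZeroLevelNullVectorAux
import Summits.RiemannHypothesis.RiemannHypothesis.Theorems.RuelleBandCofiniteCriticalLineStubZeroLevelNullVectorAux2
import Literature.NumberTheory.LFunctions.WeilSemilocalCompactnessProofs
import Literature.NumberTheory.LFunctions.WeilWindowSimpleEven
import Literature.NumberTheory.LFunctions.WeilExplicitProofs
import HarnessLib

/-!
# Stub `stub_zeroLevelNullVector`, helper file 5/5: the `L²` map, the form inner product, the compact embedding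
(item stmt-RiemannHypothesis-2064, route route-RiemannHypothesis-RuelleBand; registered stub
`stub_zeroLevelNullVector` of line `cofinite-weil-index-staircase` — "a zero min–max level of the
window form is a null vector", the attainment half of the crossing lemma).

Weil-specific layer (`Q = weilQuadratic`, `W = weilFunctional`, tests `IsWeilTest`, window
`tsupport ⊆ [-a, a]`; normalisation of `Literature/NumberTheory/LFunctions/WeilExplicit.lean`), for
a `ℂ`-submodule `V` of window test functions (`stub_zeroLevelNullVector_exists_submodule`, file 4/5):

* `…_exists_L2Map`: the injective linear `L²` map `V → L²(ℝ)`, `x ↦ [x]`, with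
  `‖[x]‖² = ∫‖x‖²`, `‖[x] - [y]‖² = ∫‖x - y‖²`, `‖[x] - v‖² = ∫‖x - v‖²`.
* `…_exists_core`: the positive definite Hermitian `InnerProductSpace.Core`
  `⟪x, y⟫ := W(y ⋆ x̃) + (1 - L₀)⟪[x], [y]⟫_{L²}` where `Re Q ≥ L₀ ∫‖·‖²` on the window
  (`weilQuadratic_re_ge_of_tsupport_subset`), so that `Re ⟪x, x⟫ = Re Q(x) + (1 - L₀)∫‖x‖² ≥ ∫‖x‖²`
  (uses the sesquilinear/Hermitian lemmas of file 1/5).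
* `…_L2Map_subseq` (registered sub-goal): the PROVED compact embedding
  `ConnesConsaniMoscovici2025_thm_3_6_holds` transported to the `L²` map — an `L²`-normalised sequence
  in `V` with `Re Q` bounded above has an `L²`-convergent subsequence of classes.

No definitions (the map and the core are produced as `∃`-witnesses), no named facts.
References: E. Bombieri, Rend. Lincei (9) 11 (2000) §§3–4; A. Connes, C. Consani, H. Moscovici,
arXiv:2511.22755 (2025), Prop. 3.3, Thm. 3.6.
-/

set_option linter.dupNamespace false -- justified: the module path repeats `RiemannHypothesis` (summit = problem); header prescribed by the line lead

noncomputable section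

open Complex MeasureTheory Filter Set
open scoped BigOperators Topology ComplexConjugate InnerProductSpace

namespace Summit.RiemannHypothesis.RiemannHypothesis.Theorems.RuelleBandCofiniteCriticalLine

open Literature.NumberTheory.LFunctions

/-! ### The core of the window as a submodule, its `L²` map, and the form inner product -/

section Core

/-- **The `L²` map of the core**: `g ↦ [g] ∈ L²(ℝ)` is an injective linear map on window test
functions with `‖[g]‖² = ∫ ‖g‖²`, `‖[g] - [h]‖² = ∫ ‖g - h‖²` and `‖[g] - v‖² = ∫ ‖g - v‖²`. [folklore] -/
theorem stub_zeroLevelNullVector_exists_L2Map (V : Submodule ℂ (ℝ → ℂ))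
    (hV : ∀ g ∈ V, IsWeilTest g) :
    ∃ L : V →ₗ[ℂ] Lp ℂ 2 (volume : Measure ℝ),
      (∀ x : V, ‖L x‖ ^ 2 = ∫ t, ‖(x : ℝ → ℂ) t‖ ^ 2) ∧ Function.Injective L ∧
      (∀ x y : V, ‖L x - L y‖ ^ 2 = ∫ t, ‖(x : ℝ → ℂ) t - (y : ℝ → ℂ) t‖ ^ 2) ∧
      (∀ (x : V) (v : Lp ℂ 2 (volume : Measure ℝ)),
        ‖L x - v‖ ^ 2 = ∫ t, ‖(x : ℝ → ℂ) t - v t‖ ^ 2) := by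
  have hmem : ∀ x : V, MemLp (x : ℝ → ℂ) 2 volume := fun x =>
    (hV x x.2).1.continuous.memLp_of_hasCompactSupport (hV x x.2).2
  set L : V →ₗ[ℂ] Lp ℂ 2 (volume : Measure ℝ) :=
    { toFun := fun x => (hmem x).toLp (x : ℝ → ℂ)
      map_add' := fun x y => by
        rw [← MemLp.toLp_add (hmem x) (hmem y)]
        rfl
      map_smul' := fun c x => by
        rw [RingHom.id_apply, ← MemLp.toLp_const_smul c (hmem x)]
        rfl } with hL
  have hLx : ∀ x, L x = (hmem x).toLp (x : ℝ → ℂ) := fun x => rfl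
  refine ⟨L, fun x => ?_, fun x y hxy => ?_, fun x y => ?_, fun x v => ?_⟩
  · rw [hLx]
    exact stub_zeroLevelNullVector_norm_toLp_sq (hmem x)
  · rw [hLx, hLx, MemLp.toLp_eq_toLp_iff] at hxy
    exact Subtype.ext ((Continuous.ae_eq_iff_eq volume (hV x x.2).1.continuous
      (hV y y.2).1.continuous).1 hxy)
  · rw [hLx, hLx]
    exact stub_zeroLevelNullVector_norm_toLp_sub_sq (hmem x) (hmem y)
  · rw [hLx, ← dist_eq_norm, stub_zeroLevelNullVector_dist_toLp (hmem x) v,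
      Real.sq_sqrt (integral_nonneg fun t => by positivity)]

/-- **The form inner product on the core**: with `C = 1 - L₀`, `L₀` a lower bound constant of
`Re Q` on the window (`Re Q(g) ≥ L₀ ∫‖g‖²`), the formula
`⟪x, y⟫ := W(y ⋆ x̃) + C ⟪[x], [y]⟫_{L²}` is a positive definite Hermitian inner product on window
test functions, with `Re ⟪x, x⟫ = Re Q(x) + C ∫‖x‖² ≥ ∫‖x‖²` (CCM25 Prop. 3.3: the window form is
lower bounded; Bombieri 2000 §4). [folklore] -/
theorem stub_zeroLevelNullVector_exists_core (V : Submodule ℂ (ℝ → ℂ)) {a : ℝ}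
    (hV : ∀ g ∈ V, IsWeilTest g ∧ tsupport g ⊆ Set.Icc (-a) a)
    (L : V →ₗ[ℂ] Lp ℂ 2 (volume : Measure ℝ))
    (hLnorm : ∀ x : V, ‖L x‖ ^ 2 = ∫ t, ‖(x : ℝ → ℂ) t‖ ^ 2) {L₀ : ℝ}
    (hL₀ : ∀ g : ℝ → ℂ, IsWeilTest g → tsupport g ⊆ Set.Icc (-a) a →
      L₀ * ∫ t, ‖g t‖ ^ 2 ≤ (weilQuadratic g).re) :
    ∃ core : InnerProductSpace.Core ℂ V, ∀ x y : V,
      core.inner x y = weilFunctional (weilConv (y : ℝ → ℂ) (weilReflect (x : ℝ → ℂ))) +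
        ((1 - L₀ : ℝ) : ℂ) * ⟪L x, L y⟫_ℂ := by
  have hV1 : ∀ x : V, IsWeilTest (x : ℝ → ℂ) := fun x => (hV x x.2).1
  have hV2 : ∀ x : V, tsupport (x : ℝ → ℂ) ⊆ Set.Icc (-a) a := fun x => (hV x x.2).2
  have hLre : ∀ x : V, (⟪L x, L x⟫_ℂ).re = ∫ t, ‖(x : ℝ → ℂ) t‖ ^ 2 := fun x => by
    rw [← hLnorm, ← RCLike.re_to_complex, inner_self_eq_norm_sq (𝕜 := ℂ)]
  have hre : ∀ x : V, (weilFunctional (weilConv (x : ℝ → ℂ) (weilReflect (x : ℝ → ℂ))) +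
      ((1 - L₀ : ℝ) : ℂ) * ⟪L x, L x⟫_ℂ).re =
      (weilQuadratic (x : ℝ → ℂ)).re + (1 - L₀) * ∫ t, ‖(x : ℝ → ℂ) t‖ ^ 2 := fun x => by
    rw [Complex.add_re, Complex.re_ofReal_mul, hLre]
    rfl
  have hre_ge : ∀ x : V, ∫ t, ‖(x : ℝ → ℂ) t‖ ^ 2 ≤
      (weilFunctional (weilConv (x : ℝ → ℂ) (weilReflect (x : ℝ → ℂ))) +
        ((1 - L₀ : ℝ) : ℂ) * ⟪L x, L x⟫_ℂ).re := fun x => by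
    rw [hre]
    have h := hL₀ (x : ℝ → ℂ) (hV1 x) (hV2 x)
    nlinarith
  refine ⟨{ inner := fun x y => weilFunctional (weilConv (y : ℝ → ℂ) (weilReflect (x : ℝ → ℂ))) +
              ((1 - L₀ : ℝ) : ℂ) * ⟪L x, L y⟫_ℂ
            conj_inner_symm := fun x y => ?_
            re_inner_nonneg := fun x => ?_
            add_left := fun x y z => ?_
            smul_left := fun x y r => ?_
            definite := fun x hx => ?_ }, fun x y => rfl⟩
  · simp only [map_add, map_mul, Complex.conj_ofReal, inner_conj_symm]
    rw [stub_zeroLevelNullVector_B_conj_symm (hV1 x) (hV1 y)]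
  · rw [RCLike.re_to_complex]
    exact (integral_nonneg fun t => by positivity).trans (hre_ge x)
  · simp only [Submodule.coe_add, map_add, inner_add_left]
    rw [stub_zeroLevelNullVector_B_add_right (hV1 z) (hV1 x) (hV1 y)]
    ring
  · simp only [Submodule.coe_smul, map_smul, inner_smul_left]
    rw [stub_zeroLevelNullVector_B_smul_right]
    ring
  · have h1 := hre_ge x
    have h0 : (weilFunctional (weilConv (x : ℝ → ℂ) (weilReflect (x : ℝ → ℂ))) +
        ((1 - L₀ : ℝ) : ℂ) * ⟪L x, L x⟫_ℂ).re = 0 := by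
      have hx' : weilFunctional (weilConv (x : ℝ → ℂ) (weilReflect (x : ℝ → ℂ))) +
          ((1 - L₀ : ℝ) : ℂ) * ⟪L x, L x⟫_ℂ = 0 := hx
      rw [hx', Complex.zero_re]
    rw [h0] at h1
    have h2 : ∫ t, ‖(x : ℝ → ℂ) t‖ ^ 2 = 0 :=
      le_antisymm h1 (integral_nonneg fun t => by positivity)
    exact Subtype.ext ((hV1 x).eq_zero_of_integral_norm_sq_eq_zero h2)

/-- **The compact embedding on the core** (the PROVED `ConnesConsaniMoscovici2025_thm_3_6_holds`,
transported to the `L²` map): an `L²`-normalised sequence of window test functions with `Re Q`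
bounded above has an `L²`-convergent subsequence.
[cite: ConnesConsaniMoscovici2025, Thm. 3.6 and Prop. 3.5] -/
theorem stub_zeroLevelNullVector_L2Map_subseq :
    ∀ (V : Submodule ℂ (ℝ → ℂ)) {a : ℝ}, 0 < a →
      (∀ g ∈ V, IsWeilTest g ∧ tsupport g ⊆ Set.Icc (-a) a) →
      ∀ (L : V →ₗ[ℂ] Lp ℂ 2 (volume : Measure ℝ)),
        (∀ (x : V) (v : Lp ℂ 2 (volume : Measure ℝ)),
          ‖L x - v‖ ^ 2 = ∫ t, ‖(x : ℝ → ℂ) t - v t‖ ^ 2) →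
        ∀ (x : ℕ → V), (∀ n, ∫ t, ‖(x n : ℝ → ℂ) t‖ ^ 2 = (1 : ℝ)) →
          BddAbove (Set.range fun n => (weilQuadratic (x n : ℝ → ℂ)).re) →
          ∃ (v : Lp ℂ 2 (volume : Measure ℝ)) (φ : ℕ → ℕ), StrictMono φ ∧
            Tendsto (fun n => L (x (φ n))) atTop (𝓝 v) := by
  intro V a ha hV L hLdist x hx1 hbdd
  obtain ⟨u, hu, φ, hφ, hconv⟩ := ConnesConsaniMoscovici2025_thm_3_6_holds a ha
    (fun n => (x n : ℝ → ℂ)) (fun n => ⟨(hV _ (x n).2).1, (hV _ (x n).2).2, hx1 n⟩) hbdd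
  refine ⟨hu.toLp u, φ, hφ, ?_⟩
  rw [tendsto_iff_norm_sub_tendsto_zero]
  have h1 : ∀ n, ‖L (x (φ n)) - hu.toLp u‖ =
      Real.sqrt (∫ t, ‖(x (φ n) : ℝ → ℂ) t - u t‖ ^ 2) := fun n => by
    rw [← Real.sqrt_sq (norm_nonneg _), hLdist]
    congr 1
    refine integral_congr_ae ?_
    filter_upwards [hu.coeFn_toLp] with t ht
    rw [ht]
  rw [show (fun n => ‖L (x (φ n)) - hu.toLp u‖) =
      fun n => Real.sqrt (∫ t, ‖(x (φ n) : ℝ → ℂ) t - u t‖ ^ 2) from funext h1]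
  have h2 := hconv.sqrt
  rw [Real.sqrt_zero] at h2
  exact h2

end Core

end Summit.RiemannHypothesis.RiemannHypothesis.Theorems.RuelleBandCofiniteCriticalLine

end
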